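import Mathlib.RingTheory.GradedAlgebra.Homogeneous.Ideal
import Mathlib.RingTheory.Ideal.AssociatedPrime.Basic
import Mathlib.RingTheory.Lasker
import HarnessLib

/-!
# Associated primes of homogeneous ideals are homogeneous

Let `A` be a commutative ring graded by `ℕ` (`𝒜 : ℕ → σ`, `GradedRing 𝒜`) and `I ⊆ A` a
homogeneous ideal. Then every prime ideal of the form `𝔭 = (I : x)` is homogeneous
(`isHomogeneous_colon_singleton_of_isPrime`); hence, for `A` Noetherian, every associated prime of
`I` — in Mathlib's sense for submodules, `Submodule.associatedPrimes I`, the primes `√(I : x)`, which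
are exactly the radicals of the components of any minimal primary decomposition of `I`
(`Submodule.IsMinimalPrimaryDecomposition.image_radical_eq_associated_primes`) — is homogeneous
(`isHomogeneous_of_mem_associatedPrimes`). This is the classical statement that the primary
components of a homogeneous ideal may be taken homogeneous and its associated primes are
homogeneous (Zariski–Samuel II, Ch. VII §2, Thm. 9 and its Corollary; Bruns–Herzog, Lemma 1.5.6),
proved here by the standard lowest-degree argument: if `a ∈ (I : x)` has lowest homogeneous
component `c`, then `c^k x ∈ I` for some `k` (induction on the number of homogeneous components of
`x` outside `I`), so `c ∈ (I : x)` by primality, and one concludes by induction on the number of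
components of `a`.

Used by `Literature/Barriers/Schanuel/NesterenkoModularScopeMeasure*.lean` (LNM 1752 Ch. 3 §5: the
primes `𝔭_j = √I_j` of a homogeneous unmixed ideal are homogeneous primes).

## References

* W. Bruns, J. Herzog, *Cohen–Macaulay rings*, rev. ed. (1998), Lemma 1.5.6.
* O. Zariski, P. Samuel, *Commutative Algebra* II (1960), Ch. VII §2, Thm. 9 and Corollary.
-/

open DirectSum

namespace Literature.RingTheory.GradedAlgebra

variable {σ A : Type*} [CommRing A] [SetLike σ A] [AddSubgroupClass σ A]
  (𝒜 : ℕ → σ) [GradedRing 𝒜]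

/-- Support of the decomposition versus vanishing of the component (coercion bookkeeping).
[folklore] -/
theorem mem_support_decompose_iff (z : A) (j : ℕ) [∀ (i : ℕ) (x : 𝒜 i), Decidable (x ≠ 0)] :
    j ∈ (decompose 𝒜 z).support ↔ (decompose 𝒜 z j : A) ≠ 0 := by
  rw [DFinsupp.mem_support_iff, not_iff_not]
  exact ZeroMemClass.coe_eq_zero.symm

/-- Components are additive: `(a - c)_j = a_j - c_j`. [folklore] -/
theorem coe_decompose_sub (a c : A) (j : ℕ) :
    (decompose 𝒜 (a - c) j : A) = (decompose 𝒜 a j : A) - (decompose 𝒜 c j : A) := by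
  have := map_sub (GradedRing.proj 𝒜 j) a c
  simpa only [GradedRing.proj_apply] using this

/-- The lowest-degree step: if `I` is homogeneous and `c ∈ 𝒜 i₀` is the lowest homogeneous
component of `a` (all components of `a` of degree `< i₀` vanish), then for every `y` with
`a y ∈ I` some `c^k y` lies in `I`. Induction on the number of homogeneous components of `y`
outside `I`. [folklore] -/
theorem exists_pow_mul_mem_of_mul_mem {I : Ideal A} (hI : I.IsHomogeneous 𝒜) {a c : A} {i₀ : ℕ}
    (hc : c ∈ 𝒜 i₀) (hlow : ∀ i, i < i₀ → (decompose 𝒜 a i : A) = 0)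
    (hci₀ : (decompose 𝒜 a i₀ : A) = c) {y : A} (hay : a * y ∈ I) :
    ∃ k : ℕ, c ^ k * y ∈ I := by
  classical
  -- `cnt y` = number of components of `y` outside `I`
  let cnt : A → ℕ := fun y =>
    ((decompose 𝒜 y).support.filter fun j => (decompose 𝒜 y j : A) ∉ I).card
  suffices H : ∀ (n : ℕ) (y : A), cnt y ≤ n → a * y ∈ I → ∃ k : ℕ, c ^ k * y ∈ I from
    H _ y le_rfl hay
  intro n
  induction n with
  | zero =>
    intro y hy hay
    refine ⟨0, ?_⟩
    rw [pow_zero, one_mul, ← sum_support_decompose 𝒜 y]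
    refine Ideal.sum_mem _ fun j hj => ?_
    by_contra hjI
    have hmem : j ∈ (decompose 𝒜 y).support.filter fun j => (decompose 𝒜 y j : A) ∉ I :=
      Finset.mem_filter.mpr ⟨hj, hjI⟩
    have h0 : cnt y = 0 := Nat.le_zero.mp hy
    rw [Finset.card_eq_zero.mp h0] at hmem
    simp at hmem
  | succ n ih =>
    intro y hy hay
    -- the components of `y` outside `I`
    let F : Finset ℕ := (decompose 𝒜 y).support.filter fun j => (decompose 𝒜 y j : A) ∉ I
    have hFcard : F.card ≤ n + 1 := hy
    have hmemF : ∀ j, j ∈ F ↔ (decompose 𝒜 y j : A) ≠ 0 ∧ (decompose 𝒜 y j : A) ∉ I := by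
      intro j
      rw [Finset.mem_filter, mem_support_decompose_iff]
    rcases Finset.eq_empty_or_nonempty F with hFe | hFne
    · exact ih y (show F.card ≤ n by rw [hFe, Finset.card_empty]; exact Nat.zero_le _) hay
    let j₀ := F.min' hFne
    have hj₀F : j₀ ∈ F := Finset.min'_mem F _
    have hj₀min : ∀ j ∈ F, j₀ ≤ j := fun j hj => Finset.min'_le F j hj
    -- the component of `a y` of degree `i₀ + j₀` is `c y_{j₀}` modulo `I`
    have hcy : c * (decompose 𝒜 y j₀ : A) ∈ I := by
      have hcomp : (decompose 𝒜 (a * y) (i₀ + j₀) : A) ∈ I := hI _ hay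
      rw [decompose_mul, coe_mul_apply] at hcomp
      -- every pair `(i, j) ≠ (i₀, j₀)` with `i + j = i₀ + j₀` contributes an element of `I`
      have hrest : ∀ ij ∈ ((decompose 𝒜 a).support ×ˢ (decompose 𝒜 y).support).filter
          (fun ij : ℕ × ℕ => ij.1 + ij.2 = i₀ + j₀), ij ≠ (i₀, j₀) →
          ((decompose 𝒜 a ij.1 : A) * (decompose 𝒜 y ij.2 : A)) ∈ I := by
        rintro ⟨i, j⟩ hij hne
        rw [Finset.mem_filter, Finset.mem_product, mem_support_decompose_iff,
          mem_support_decompose_iff] at hij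
        obtain ⟨⟨hi, hj⟩, hsum⟩ := hij
        simp only at hsum hi hj
        rcases lt_trichotomy i i₀ with hlt | heq | hgt
        · exact absurd (hlow i hlt) hi
        · subst heq
          have hjj : j = j₀ := by omega
          subst hjj
          exact absurd rfl hne
        · have hjlt : j < j₀ := by omega
          have hjI : (decompose 𝒜 y j : A) ∈ I := by
            by_contra hjI
            exact absurd (hj₀min j ((hmemF j).mpr ⟨hj, hjI⟩)) (not_le.mpr hjlt)
          exact I.mul_mem_left _ hjI
      by_cases hmem : (i₀, j₀) ∈ ((decompose 𝒜 a).support ×ˢ (decompose 𝒜 y).support).filter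
          (fun ij : ℕ × ℕ => ij.1 + ij.2 = i₀ + j₀)
      · rw [← Finset.add_sum_erase _ _ hmem] at hcomp
        have hsum : (∑ ij ∈ (((decompose 𝒜 a).support ×ˢ (decompose 𝒜 y).support).filter
            (fun ij : ℕ × ℕ => ij.1 + ij.2 = i₀ + j₀)).erase (i₀, j₀),
            ((decompose 𝒜 a ij.1 : A) * (decompose 𝒜 y ij.2 : A))) ∈ I :=
          Ideal.sum_mem _ fun ij hij =>
            hrest ij (Finset.mem_of_mem_erase hij) (Finset.ne_of_mem_erase hij)
        have := I.sub_mem hcomp hsum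
        rwa [add_sub_cancel_right, hci₀] at this
      · -- `(i₀, j₀)` is not an index: `a_{i₀} = 0` or `y_{j₀} = 0`
        rw [Finset.mem_filter, Finset.mem_product, mem_support_decompose_iff,
          mem_support_decompose_iff] at hmem
        simp only [and_true, not_and_or, not_not] at hmem
        rcases hmem with h | h
        · rw [← hci₀, h, zero_mul]; exact I.zero_mem
        · rw [h, mul_zero]; exact I.zero_mem
    -- pass to `y' = c y`, which has fewer components outside `I`
    let F' : Finset ℕ :=
      (decompose 𝒜 (c * y)).support.filter fun l => (decompose 𝒜 (c * y) l : A) ∉ I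
    have hsub : ∀ l ∈ F', i₀ ≤ l ∧ l - i₀ ∈ F.erase j₀ := by
      intro l hl
      rw [Finset.mem_filter, mem_support_decompose_iff] at hl
      obtain ⟨hl0, hlI⟩ := hl
      have e := coe_decompose_mul_of_left_mem 𝒜 l hc (b := y)
      by_cases hil : i₀ ≤ l
      · rw [if_pos hil] at e
        rw [e] at hlI hl0
        refine ⟨hil, Finset.mem_erase.mpr ⟨?_, (hmemF _).mpr ⟨?_, ?_⟩⟩⟩
        · intro heq
          rw [heq] at hlI
          exact hlI hcy
        · intro h0
          rw [h0, mul_zero] at hl0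
          exact hl0 rfl
        · exact fun h => hlI (I.mul_mem_left _ h)
      · rw [if_neg hil] at e
        exact absurd e hl0
    have hcard : F'.card ≤ n := by
      calc F'.card ≤ (F.erase j₀).card := by
            refine Finset.card_le_card_of_injOn (fun l => l - i₀) (fun l hl => (hsub l hl).2) ?_
            intro l₁ hl₁ l₂ hl₂ h
            have h1 := (hsub l₁ hl₁).1
            have h2 := (hsub l₂ hl₂).1
            simp only at h
            omega
        _ ≤ n := by
            rw [Finset.card_erase_of_mem hj₀F]
            omega
    obtain ⟨k, hk⟩ := ih (c * y) hcard (by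
      rw [mul_left_comm]
      exact I.mul_mem_left c hay)
    exact ⟨k + 1, by rw [pow_succ, mul_assoc]; exact hk⟩

/-- **A prime ideal of the form `(I : x)` with `I` homogeneous is homogeneous** (Bruns–Herzog,
Lemma 1.5.6: the lowest homogeneous component `c` of `a ∈ (I : x)` satisfies `c^k x ∈ I`, hence
`c ∈ (I : x)`; induct on the number of components of `a`). [folklore] -/
theorem isHomogeneous_colon_singleton_of_isPrime {I : Ideal A} (hI : I.IsHomogeneous 𝒜) (x : A)
    (hp : (Submodule.colon I {x}).IsPrime) : (Submodule.colon I {x}).IsHomogeneous 𝒜 := by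
  classical
  suffices H : ∀ (n : ℕ) (a : A), (decompose 𝒜 a).support.card ≤ n →
      a ∈ Submodule.colon I {x} → ∀ i, (decompose 𝒜 a i : A) ∈ Submodule.colon I {x} from
    fun i a ha => H _ a le_rfl ha i
  have hmem_colon : ∀ b : A, b ∈ Submodule.colon I {x} ↔ b * x ∈ I := fun b => by
    rw [Submodule.mem_colon_singleton, smul_eq_mul]
  intro n
  induction n with
  | zero =>
    intro a ha _ i
    have h0 : (decompose 𝒜 a i : A) = 0 := by
      by_contra h
      have : i ∈ (decompose 𝒜 a).support := (mem_support_decompose_iff 𝒜 a i).mpr h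
      rw [Finset.card_eq_zero.mp (Nat.le_zero.mp ha)] at this
      simp at this
    rw [h0]
    exact Submodule.zero_mem _
  | succ n ih =>
    intro a ha hax i
    rcases Finset.eq_empty_or_nonempty (decompose 𝒜 a).support with ha0 | hane
    · have h0 : (decompose 𝒜 a i : A) = 0 := by
        by_contra h
        have : i ∈ (decompose 𝒜 a).support := (mem_support_decompose_iff 𝒜 a i).mpr h
        rw [ha0] at this
        simp at this
      rw [h0]
      exact Submodule.zero_mem _
    let i₀ := (decompose 𝒜 a).support.min' hane
    have hi₀mem : i₀ ∈ (decompose 𝒜 a).support := Finset.min'_mem _ _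
    have hc : (decompose 𝒜 a i₀ : A) ∈ 𝒜 i₀ := (decompose 𝒜 a i₀).2
    have hlow : ∀ j, j < i₀ → (decompose 𝒜 a j : A) = 0 := by
      intro j hj
      by_contra h
      have : j ∈ (decompose 𝒜 a).support := (mem_support_decompose_iff 𝒜 a j).mpr h
      exact absurd (Finset.min'_le _ j this) (not_le.mpr hj)
    -- `c = a_{i₀} ∈ (I : x)`
    obtain ⟨k, hk⟩ :=
      exists_pow_mul_mem_of_mul_mem 𝒜 hI hc hlow rfl ((hmem_colon a).mp hax)
    have hcx : (decompose 𝒜 a i₀ : A) ∈ Submodule.colon I {x} :=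
      hp.mem_of_pow_mem k ((hmem_colon _).mpr hk)
    -- `a - c` has fewer components, all in `(I : x)` by induction
    have hdec : ∀ j, (decompose 𝒜 (a - (decompose 𝒜 a i₀ : A)) j : A) =
        if j = i₀ then 0 else (decompose 𝒜 a j : A) := by
      intro j
      rw [coe_decompose_sub]
      by_cases hj : j = i₀
      · subst hj
        rw [if_pos rfl, decompose_of_mem_same 𝒜 hc, sub_self]
      · rw [if_neg hj, decompose_of_mem_ne 𝒜 hc (Ne.symm hj), sub_zero]
    have hcard : (decompose 𝒜 (a - (decompose 𝒜 a i₀ : A))).support.card ≤ n := by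
      have hsub : (decompose 𝒜 (a - (decompose 𝒜 a i₀ : A))).support ⊆
          (decompose 𝒜 a).support.erase i₀ := by
        intro j hj
        rw [mem_support_decompose_iff, hdec j] at hj
        rw [Finset.mem_erase, mem_support_decompose_iff]
        by_cases hji : j = i₀
        · rw [if_pos hji] at hj; exact absurd rfl hj
        · rw [if_neg hji] at hj; exact ⟨hji, hj⟩
      calc (decompose 𝒜 (a - (decompose 𝒜 a i₀ : A))).support.card
          ≤ ((decompose 𝒜 a).support.erase i₀).card := Finset.card_le_card hsub
        _ ≤ n := by
            rw [Finset.card_erase_of_mem hi₀mem]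
            have : (decompose 𝒜 a).support.card ≤ n + 1 := ha
            omega
    have hi := ih _ hcard (Submodule.sub_mem _ hax hcx) i
    rw [hdec i] at hi
    by_cases hii : i = i₀
    · subst hii; exact hcx
    · rwa [if_neg hii] at hi

/-- **Associated primes of a homogeneous ideal of a Noetherian graded ring are homogeneous**
(Bruns–Herzog Lemma 1.5.6; Zariski–Samuel II, VII §2 Thm. 9, Cor.): here for Mathlib's
`Submodule.associatedPrimes I` (the primes `√(I : x)`, `= (I : x')` in the Noetherian case), i.e.
for the radicals of the components of any minimal primary decomposition of `I`. [folklore] -/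
theorem isHomogeneous_of_mem_associatedPrimes [IsNoetherianRing A] {I : Ideal A}
    (hI : I.IsHomogeneous 𝒜) {p : Ideal A} (hp : p ∈ I.associatedPrimes) :
    p.IsHomogeneous 𝒜 := by
  obtain ⟨hprime, x, rfl⟩ := Submodule.isAssociatedPrime_iff.mp hp
  exact isHomogeneous_colon_singleton_of_isPrime 𝒜 hI x hprime

end Literature.RingTheory.GradedAlgebra
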